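import Mathlib.Analysis.SpecialFunctions.Integrals.Basic
import Mathlib.Analysis.SpecialFunctions.Gamma.Basic
import Mathlib.Analysis.SpecialFunctions.Gaussian.GaussianIntegral
import HarnessLib

/-!
# Spherical caps on `S^{d−1}`: the cap measure ratio `C_d(θ)` and its density `A_d(θ)` (Albrecht–Gheorghiu–Postlethwaite–Schanck 2020, §2)

Verbatim typed DEFINITIONS from [AlbrechtEtAl2020QuantumSieves] (ASIACRYPT 2020, LNCS 12492, §2 "Preliminaries",
p. 590), the geometric probabilities that every nearest-neighbour-search cost formula of that paper is built from
(filtered quantum/classical sieving cost estimates; the list size `N(d) ≈ 2/C_d(π/3)`, §6 and p. 609):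

* `capRatio d θ` — printed: "`C_d(u, θ) := μ^{d−1}(C^{d−1}(u, θ)) = (1/√π)·Γ(d/2)/Γ((d−1)/2)·∫₀^θ sin^{d−2}(t) dt`
  … We will often interpret `C_d(u, θ)` as the probability that `v` drawn uniformly from `S^{d−1}` satisfies
  `θ(u, v) ≤ θ`. … `C_d(u, θ)` does not depend on `u`, so we may write `C_d(θ)`" (the normalised
  `(d−1)`-dimensional spherical measure of the cap of angle `θ`);
* `capDensity d θ` — printed: "`A_d(u, θ) := ∂/∂θ C_d(u, θ) = (1/√π)·Γ(d/2)/Γ((d−1)/2)·sin^{d−2}(θ)`".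

Only the printed closed-form right-hand sides are typed (as functions of a natural dimension `d ≥ 2` and a real
angle); the measure-theoretic left-hand sides (uniform measure on the sphere) are not needed by any user and are
not restated. No theorem of the paper is asserted here. Users: the `Ventures/LatticeEstimator` cell (kernel
evaluation of `C_d(π/3)` in closed form, `Summits/Ventures/LatticeEstimator/Numerics/SphericalCap.lean`).

## References
* [AlbrechtEtAl2020QuantumSieves] M. R. Albrecht, V. Gheorghiu, E. W. Postlethwaite, J. M. Schanck, *Estimating
  quantum speedups for lattice sieves*, ASIACRYPT 2020, LNCS 12492, pp. 583–613, §2 p. 590.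
-/


noncomputable section

namespace Literature.Computability.Cryptography.AGPS20

/-- The spherical-cap measure ratio `C_d(θ) = (1/√π)·Γ(d/2)/Γ((d−1)/2)·∫₀^θ sin^{d−2}(t) dt` — the probability that a
uniformly random point of `S^{d−1}` makes an angle at most `θ` with a fixed point (independent of that point).
[cite: AlbrechtEtAl2020QuantumSieves, §2 p. 590, display defining `C_d(u, θ)`] -/
def capRatio (d : ℕ) (θ : ℝ) : ℝ :=
  1 / Real.sqrt Real.pi * (Real.Gamma ((d : ℝ) / 2) / Real.Gamma (((d : ℝ) - 1) / 2)) *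
    ∫ t in (0 : ℝ)..θ, Real.sin t ^ (d - 2)

/-- The cap density `A_d(θ) = ∂C_d/∂θ = (1/√π)·Γ(d/2)/Γ((d−1)/2)·sin^{d−2}(θ)`.
[cite: AlbrechtEtAl2020QuantumSieves, §2 p. 590, display defining `A_d(u, θ)`] -/
def capDensity (d : ℕ) (θ : ℝ) : ℝ :=
  1 / Real.sqrt Real.pi * (Real.Gamma ((d : ℝ) / 2) / Real.Gamma (((d : ℝ) - 1) / 2)) * Real.sin θ ^ (d - 2)

/-- The printed relation `A_d = ∂C_d/∂θ` between the two displays (fundamental theorem of calculus for the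
continuous integrand `sin^{d−2}`). [cite: AlbrechtEtAl2020QuantumSieves, §2 p. 590] -/
theorem hasDerivAt_capRatio (d : ℕ) (θ : ℝ) : HasDerivAt (capRatio d) (capDensity d θ) θ := by
  unfold capRatio capDensity
  have hc : Continuous fun t : ℝ => Real.sin t ^ (d - 2) := by fun_prop
  have h := (intervalIntegral.integral_hasDerivAt_right (hc.intervalIntegrable 0 θ)
    hc.aestronglyMeasurable.stronglyMeasurableAtFilter hc.continuousAt)
  exact h.const_mul _

/-! ### Normalisation: the cap of angle `π` is the whole sphere, `C_d(π) = 1` -/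

/-- Recursion behind the normalisation: `C_{d+2}(π) = C_d(π)` for `d ≥ 2` (from `Γ(x+1) = xΓ(x)` and the reduction formula
`∫₀^π sin^{n+2} = (n+1)/(n+2)·∫₀^π sin^n`). [cite: AlbrechtEtAl2020QuantumSieves, §2 p. 590 (footnote 2: `μ^{d−1}(S^{d−1}) = 1`)] -/
theorem capRatio_pi_add_two {d : ℕ} (hd : 2 ≤ d) : capRatio (d + 2) Real.pi = capRatio d Real.pi := by
  unfold capRatio
  have hd' : (2 : ℝ) ≤ d := by exact_mod_cast hd
  have e1 : (((d + 2 : ℕ) : ℝ)) / 2 = (d : ℝ) / 2 + 1 := by push_cast; ring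
  have e2 : ((((d + 2 : ℕ) : ℝ)) - 1) / 2 = ((d : ℝ) - 1) / 2 + 1 := by push_cast; ring
  have hsub : d + 2 - 2 = (d - 2) + 2 := by omega
  rw [e1, e2, Real.Gamma_add_one (by linarith : (d : ℝ) / 2 ≠ 0), Real.Gamma_add_one (by linarith : ((d : ℝ) - 1) / 2 ≠ 0),
    hsub, integral_sin_pow, Real.sin_zero, Real.sin_pi]
  have hn : (((d - 2 : ℕ) : ℕ) : ℝ) = (d : ℝ) - 2 := by rw [Nat.cast_sub hd]; push_cast; ring
  rw [zero_pow (Nat.succ_ne_zero _)]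
  simp only [zero_mul, sub_zero, zero_div, zero_add]
  rw [hn]
  have hG1 : Real.Gamma ((d : ℝ) / 2) ≠ 0 := (Real.Gamma_pos_of_pos (by linarith)).ne'
  have hG2 : Real.Gamma (((d : ℝ) - 1) / 2) ≠ 0 := (Real.Gamma_pos_of_pos (by linarith)).ne'
  have h1 : (d : ℝ) - 2 + 2 ≠ 0 := by linarith
  have h2 : ((d : ℝ) - 1) / 2 ≠ 0 := by linarith
  have h3 : (d : ℝ) - 1 ≠ 0 := by linarith
  have h4 : (-1 : ℝ) + d ≠ 0 := by linarith
  field_simp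
  ring

/-- `C_2(π) = 1`. [cite: AlbrechtEtAl2020QuantumSieves, §2 p. 590 (footnote 2)] -/
theorem capRatio_two_pi : capRatio 2 Real.pi = 1 := by
  unfold capRatio
  have e1 : (((2 : ℕ) : ℝ)) / 2 = 1 := by norm_num
  have e2 : ((((2 : ℕ) : ℝ)) - 1) / 2 = 1 / 2 := by norm_num
  rw [e1, e2, Real.Gamma_one, Real.Gamma_one_half_eq, show 2 - 2 = 0 by rfl]
  simp only [pow_zero, intervalIntegral.integral_const, smul_eq_mul, mul_one, sub_zero]
  have hpi : Real.sqrt Real.pi ≠ 0 := (Real.sqrt_pos.2 Real.pi_pos).ne'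
  field_simp
  rw [Real.sq_sqrt Real.pi_pos.le]

/-- `C_3(π) = 1`. [cite: AlbrechtEtAl2020QuantumSieves, §2 p. 590 (footnote 2)] -/
theorem capRatio_three_pi : capRatio 3 Real.pi = 1 := by
  unfold capRatio
  have e1 : (((3 : ℕ) : ℝ)) / 2 = 1 / 2 + 1 := by norm_num
  have e2 : ((((3 : ℕ) : ℝ)) - 1) / 2 = 1 := by norm_num
  rw [e1, e2, Real.Gamma_add_one (by norm_num), Real.Gamma_one, Real.Gamma_one_half_eq, show 3 - 2 = 1 by rfl]
  simp only [pow_one, integral_sin, Real.cos_zero, Real.cos_pi]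
  have hpi : Real.sqrt Real.pi ≠ 0 := (Real.sqrt_pos.2 Real.pi_pos).ne'
  field_simp
  norm_num

/-- **Normalisation `C_d(π) = 1` for every `d ≥ 2`** — the cap of angle `π` is all of `S^{d−1}` and `μ^{d−1}` is a probability measure
(printed, footnote 2 p. 590); here it certifies the typed closed form's constant `(1/√π)·Γ(d/2)/Γ((d−1)/2)`.
[cite: AlbrechtEtAl2020QuantumSieves, §2 p. 590 (footnote 2: `μ^{d−1}(S^{d−1}) = 1`)] -/
theorem capRatio_pi {d : ℕ} (hd : 2 ≤ d) : capRatio d Real.pi = 1 := by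
  induction d using Nat.strong_induction_on with
  | _ d ih =>
    rcases Nat.lt_or_ge d 4 with h4 | h4
    · interval_cases d
      · exact capRatio_two_pi
      · exact capRatio_three_pi
    · have hd2 : 2 ≤ d - 2 := by omega
      have e : d = (d - 2) + 2 := by omega
      rw [e, capRatio_pi_add_two hd2]
      exact ih (d - 2) (by omega) hd2

end Literature.Computability.Cryptography.AGPS20

end
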